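import Literature.MathematicalPhysics.QuantumLattice.FermionicTreeExpansion
import Literature.Probability.LatticeModels.BattleFederbushGram
import Literature.Probability.LatticeModels.BattleFederbushWeights
import Literature.MeasureTheory.Integral.PolynomialCubeIntegral
import Literature.Analysis.InnerProduct.GramHadamardUnitRows
import HarnessLib

/-!
# The `n!`-free bound on truncated fermionic expectations (Gram–Hadamard on the tree expansion)

Topic `Literature/MathematicalPhysics/QuantumLattice`; the second half of Benfatto–Giuliani–
Mastropietro 2006, (2.66) / Mastropietro 2008, §2.9: combining the tree expansion of the truncated
expectation (`FermionicTreeExpansion.lean`), the Gram structure of the interpolation factors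
(`BattleFederbushGram.lean`), the probability normalisation of the interpolation weights
(`BattleFederbushWeights.lean`) and the Gram–Hadamard inequality with unit rows
(`GramHadamardUnitRows.lean`), one obtains the basic estimate of constructive fermionic theory:
for a propagator in **Gram form** `G f f' = ⟪A f, B f'⟫` the truncated expectation of the balanced
monomials of the clusters in `W` is bounded by the sum over the valid scripts spanning `W` (rooted
anywhere in `W`), and over the anchored field-line assignments along their lines, of
`∏_ℓ ‖G_ℓ‖ · ∏_{rows left} ‖A_f‖ · ∏_{columns left} ‖B_{f'}‖ · ∫ w_s` — no factorial in the number
of fields, since the remaining determinant is bounded by Gram–Hadamard uniformly in the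
interpolation parameters ("a standard application of Gram–Hadamard inequality", BGM 2006 before
(2.80); Mastropietro 2008, Lemma 2.2 and (2.118)–(2.119)).

## Main results (namespace `Literature.MathematicalPhysics.QuantumLattice.FermionicTree`)

* `tens w a` — the vector `w ⊗ a ∈ ℓ²(Fin m; E)` with `⟪w ⊗ a, w' ⊗ b⟫ = ⟪w, w'⟫ ⟪a, b⟫`;
* `assignBound` — the recursive bound mirroring `assignSum` with `‖G‖` in place of `G` and the
  Gram–Hadamard product in place of the final determinant; `norm_eval_aeval_assignSum_le`;
* `norm_cubeIntegral_map_mul_le` — `‖∫ w X‖ ≤ sup ‖X‖ · ∫ w` for a weight `w ≥ 0` on the cube;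
* `norm_scriptTerm_le`, `norm_ursellOf_moment_le` — **the bound on `𝓔ᵀ`** in script form.

## Sources

G. Benfatto, A. Giuliani, V. Mastropietro, Ann. Henri Poincaré 7 (2006), (2.66) and the paragraph
before (2.80) (`BenfattoGiulianiMastropietro2006`); V. Mastropietro, *Non-Perturbative
Renormalization* (2008), Lemma 2.2 (2.66), §2.9 (2.118)–(2.119), PDF pp. 42–43, 48–49
(`Mastropietro2008`).  Everything is proved; no named fact.
-/

noncomputable section

open MvPolynomial Finsupp Matrix Finset Literature.RingTheory.MvPolynomial
open Literature.Probability.LatticeModels Literature.Probability.LatticeModels.BattleFederbush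
open Literature.MeasureTheory.Integral Literature.Analysis.InnerProduct _root_.MeasureTheory
open scoped InnerProductSpace

namespace Literature.MathematicalPhysics.QuantumLattice

namespace FermionicTree

variable {𝕜 : Type*} [RCLike 𝕜] {E : Type*} [NormedAddCommGroup E] [InnerProductSpace 𝕜 E]

/-! ### Tensor vectors `w ⊗ a` -/

section Tens

variable {m : ℕ}

variable (𝕜) in
/-- The vector `w ⊗ a ∈ ℓ²(Fin m; E)`, `(w ⊗ a)_p = w_p a`, for a real vector `w ∈ ℝ^m`. [folklore] -/
def tens (w : EuclideanSpace ℝ (Fin m)) (a : E) : PiLp 2 (fun _ : Fin m => E) :=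
  WithLp.toLp 2 fun p => ((WithLp.ofLp w p : ℝ) : 𝕜) • a

/-- `⟪w ⊗ a, w' ⊗ b⟫ = ⟪w, w'⟫ · ⟪a, b⟫`. [folklore] -/
theorem inner_tens (w w' : EuclideanSpace ℝ (Fin m)) (a b : E) :
    ⟪tens 𝕜 w a, tens 𝕜 w' b⟫_𝕜 = ((⟪w, w'⟫_ℝ : ℝ) : 𝕜) * ⟪a, b⟫_𝕜 := by
  simp only [tens, PiLp.inner_apply, inner_smul_left, inner_smul_right, RCLike.conj_ofReal,
    RCLike.inner_apply, conj_trivial]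
  push_cast
  rw [Finset.sum_mul]
  exact Finset.sum_congr rfl fun p _ => by ring

/-- `‖w ⊗ a‖ = ‖w‖ ‖a‖`. [folklore] -/
theorem norm_tens (w : EuclideanSpace ℝ (Fin m)) (a : E) : ‖tens 𝕜 w a‖ = ‖w‖ * ‖a‖ := by
  have h : ‖tens 𝕜 w a‖ ^ 2 = (‖w‖ * ‖a‖) ^ 2 := by
    rw [@norm_sq_eq_re_inner 𝕜, inner_tens, real_inner_self_eq_norm_sq, mul_pow,
      norm_sq_eq_re_inner (𝕜 := 𝕜) a, RCLike.re_ofReal_mul]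
  exact (sq_eq_sq₀ (norm_nonneg _) (mul_nonneg (norm_nonneg _) (norm_nonneg _))).1 h

end Tens

/-! ### Evaluation of the interpolation polynomials at real points -/

section Eval

variable {ι : Type*} [Fintype ι] [DecidableEq ι] {v : ι} {k : ℕ}

omit [Fintype ι] [DecidableEq ι] in
/-- Casting commutes with evaluation at real points: `p(t) ∈ 𝕜` for the `𝕜`-version of a real
polynomial is the cast of the real value. [folklore] -/
theorem eval_map_algebraMap (w : MvPolynomial ι ℝ) (t : ι → ℝ) :
    eval (fun i => (t i : 𝕜)) (MvPolynomial.map (algebraMap ℝ 𝕜) w) = ((eval t w : ℝ) : 𝕜) := by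
  rw [eval_map]
  have h := eval₂_comp_left (algebraMap ℝ 𝕜) (RingHom.id ℝ) t w
  rw [RingHom.comp_id] at h
  exact h.symm

omit [Fintype ι] in
/-- The decoupled interpolation point over `𝕜` is the `𝕜`-version of the real one. [folklore] -/
theorem decPt_eq_map (s : Script v k) (ℓ : Sym2 ι) :
    s.decPt 𝕜 ℓ = MvPolynomial.map (algebraMap ℝ 𝕜) (s.decPt ℝ ℓ) := by
  simp only [Script.decPt, Script.livePt]
  split_ifs <;> simp [map_monomial]

omit [Fintype ι] in
/-- The weight over `𝕜` is the `𝕜`-version of the real weight. [folklore] -/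
theorem weight_eq_map (s : Script v k) : s.weight 𝕜 = MvPolynomial.map (algebraMap ℝ 𝕜) (s.weight ℝ) := by
  simp [Script.weight, map_monomial]

omit [Fintype ι] in
/-- The real weight is nonnegative on the unit cube. [folklore] -/
theorem eval_weight_nonneg (s : Script v k) {t : ι → ℝ} (ht : t ∈ unitCube ι) : 0 ≤ eval t (s.weight ℝ) := by
  rw [Script.weight, eval_monomial, one_mul, Finsupp.prod]
  exact Finset.prod_nonneg fun i _ => pow_nonneg ((mem_unitCube.1 ht) i).1 _

end Eval

/-! ### The recursive bound -/

section Bound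

variable {ι : Type*} [Fintype ι] [DecidableEq ι] {F : Type*} [Fintype F] [LinearOrder F]
variable (c : F → ι) (A B : F → E)

variable (𝕜) in
/-- The propagator in Gram form, `G f f' = ⟪A f, B f'⟫`. [folklore] -/
def gramProp : Matrix F F 𝕜 := Matrix.of fun f f' => ⟪A f, B f'⟫_𝕜

variable (𝕜) in
/-- The **recursive bound** mirroring `assignSum`: `‖G‖` for each extracted tree line and, at the
end, the Gram–Hadamard product `∏_{rows left} ‖A‖ · ∏_{columns left} ‖B‖` of the remaining fields
(Mastropietro 2008, (2.118) with Lemma 2.2). [folklore] -/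
def assignBound {r : ℕ} (e : Fin r → F) : List (Sym2 ι) → Finset F → (F → F) → ℝ
  | [], I, jm => (∏ a ∈ univ.filter (fun a => e a ∉ I), ‖A (e a)‖) *
      ∏ b ∈ univ.filter (fun b => ∀ a, e a ∈ I → jm (e a) ≠ e b), ‖B (e b)‖
  | ℓ :: L, I, jm => ∑ i, ∑ j,
      if e i ∉ I ∧ s(c (e i), c (e j)) = ℓ then
        ‖(⟪A (e i), B (e j)⟫_𝕜 : 𝕜)‖ * assignBound e L (insert (e i) I) (Function.update jm (e i) (e j))
      else 0

omit [Fintype ι] [Fintype F] in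
/-- The recursive bound is nonnegative. [folklore] -/
theorem assignBound_nonneg {r : ℕ} (e : Fin r → F) : ∀ (L : List (Sym2 ι)) (I : Finset F) (jm : F → F),
    0 ≤ assignBound 𝕜 c A B e L I jm
  | [], I, jm => mul_nonneg (prod_nonneg fun _ _ => norm_nonneg _) (prod_nonneg fun _ _ => norm_nonneg _)
  | ℓ :: L, I, jm => sum_nonneg fun i _ => sum_nonneg fun j _ => by
    split_ifs
    · exact mul_nonneg (norm_nonneg _) (assignBound_nonneg e L _ _)
    · exact le_rfl

variable {v : ι} {k : ℕ}

omit [Fintype ι] in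
/-- **The interpolated determinant is bounded by Gram–Hadamard, uniformly in the parameters** and
the bound propagates through the line extractions: for `t ∈ [0,1]^ι`,
`‖(assignSum_Q L I jm)(σ_s(t))‖ ≤ assignBound L I jm` (Benfatto–Giuliani–Mastropietro 2006:
`|det G^{h,T}(t)| ≤ C^{…}` by Gram–Hadamard, the `t_{ii'} = u_i·u_{i'}` being inner products of unit
vectors). [cite: BenfattoGiulianiMastropietro2006, (2.66) and text before (2.80)] -/
theorem norm_eval_aeval_assignSum_le (s : Script v k) (hs : s.Valid) {t : ι → ℝ} (ht : t ∈ unitCube ι) :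
    ∀ (L : List (Sym2 ι)) (I : Finset F) (jm : F → F)
      (_ : ∀ a ∈ I, c a ∈ univ.image s.y ∧ c (jm a) ∈ univ.image s.y),
      ‖eval (fun i => (t i : 𝕜)) (aeval (s.decPt 𝕜)
        (assignSum c (gramProp 𝕜 A B) (enum c (univ.image s.y)) L I jm))‖ ≤
        assignBound 𝕜 c A B (enum c (univ.image s.y)) L I jm
  | [], I, jm, hI => by
    set Q := univ.image s.y with hQ
    set e := enum c Q with he
    -- the Gram vectors of the interpolation factors
    obtain ⟨u, hu1, hu⟩ := Script.exists_unit_gram s hs t (fun x => (mem_unitCube.1 ht) x)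
    -- positions of the clusters of the fields of `Q`
    have hpos : ∀ a : Fin (fieldsOf c Q).card, ∃ p : Fin (k + 1), s.y p = c (e a) := fun a => by
      obtain ⟨p, -, hp⟩ := mem_image.1 (c_enum_mem c Q a); exact ⟨p, hp⟩
    choose pos hpos using hpos
    -- the column index of the unit rows
    let jidx : Fin (fieldsOf c Q).card → Fin (fieldsOf c Q).card := fun a =>
      if h : jm (e a) ∈ fieldsOf c Q then ((fieldsOf c Q).orderIsoOfFin rfl).symm ⟨jm (e a), h⟩ else a
    have hjidx : ∀ a, e a ∈ I → e (jidx a) = jm (e a) := by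
      intro a ha
      have h : jm (e a) ∈ fieldsOf c Q := (mem_fieldsOf c).2 (hI _ ha).2
      have hj : jidx a = ((fieldsOf c Q).orderIsoOfFin rfl).symm ⟨jm (e a), h⟩ := dif_pos h
      rw [hj]
      show ((fieldsOf c Q).orderEmbOfFin rfl) (((fieldsOf c Q).orderIsoOfFin rfl).symm ⟨jm (e a), h⟩) = jm (e a)
      rw [← Finset.coe_orderIsoOfFin_apply, OrderIso.apply_symm_apply]
    -- the evaluated matrix
    set I' : Finset (Fin (fieldsOf c Q).card) := univ.filter fun a => e a ∈ I with hI'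
    set N : Matrix (Fin (fieldsOf c Q).card) (Fin (fieldsOf c Q).card) 𝕜 :=
      ((tmpl c (gramProp 𝕜 A B) e I jm).map (aeval (s.decPt 𝕜))).map (eval fun i => (t i : 𝕜)) with hN
    have hdet : eval (fun i => (t i : 𝕜)) (aeval (s.decPt 𝕜) (assignSum c (gramProp 𝕜 A B) e [] I jm)) = N.det := by
      rw [assignSum, AlgHom.map_det, RingHom.map_det, AlgHom.mapMatrix_apply, RingHom.mapMatrix_apply]
    have hentry : ∀ a b, N a b = if a ∈ I' then (if b = jidx a then 1 else 0)
        else ⟪tens 𝕜 (u (pos a)) (A (e a)), tens 𝕜 (u (pos b)) (B (e b))⟫_𝕜 := by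
      intro a b
      simp only [hN, map_apply, tmpl, hI', mem_filter, mem_univ, true_and]
      by_cases ha : e a ∈ I
      · simp only [if_pos ha]
        by_cases hb : b = jidx a
        · subst hb
          simp [hjidx a ha]
        · have hne : e b ≠ jm (e a) := fun h => hb (e.injective (h.trans (hjidx a ha).symm))
          simp [hne, hb]
      · simp only [if_neg ha, map_mul, aeval_X, aeval_C, MvPolynomial.algebraMap_eq, eval_C, inner_tens,
          gramProp, Matrix.of_apply]
        congr 1
        rw [decPt_eq_map, eval_map_algebraMap, ← hpos a, ← hpos b, hu]
    rw [hdet]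
    refine (norm_det_le_of_unit_rows N I' jidx _ _ hentry).trans (le_of_eq ?_)
    rw [assignBound]
    congr 1
    · refine prod_congr (by ext a; simp [hI']) fun a _ => ?_
      rw [norm_tens, hu1, one_mul]
    · refine prod_congr ?_ fun b _ => by rw [norm_tens, hu1, one_mul]
      ext b
      simp only [mem_filter, mem_univ, true_and, mem_image, hI', not_exists, not_and]
      constructor
      · intro h a ha hab
        exact h a ha (e.injective ((hjidx a ha).trans hab))
      · intro h a ha hab
        exact h a ha ((hjidx a ha).symm.trans (congrArg e hab))
  | ℓ :: L, I, jm, hI => by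
    set Q := univ.image s.y with hQ
    rw [assignSum, assignBound, map_sum, map_sum]
    refine (norm_sum_le _ _).trans (sum_le_sum fun i _ => ?_)
    rw [map_sum, map_sum]
    refine (norm_sum_le _ _).trans (sum_le_sum fun j _ => ?_)
    split_ifs with h
    · rw [map_mul, map_mul, aeval_C, MvPolynomial.algebraMap_eq, eval_C, norm_mul]
      refine mul_le_mul_of_nonneg_left (norm_eval_aeval_assignSum_le s hs ht L _ _ fun a ha => ?_) (norm_nonneg _)
      have hℓ : ∀ x ∈ ℓ, x ∈ Q := by
        intro x hx
        rw [← h.2] at hx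
        rcases Sym2.mem_iff.1 hx with rfl | rfl <;> exact c_enum_mem c Q _
      rcases mem_insert.1 ha with rfl | ha
      · rw [Function.update_self]
        exact ⟨hℓ _ (h.2 ▸ Sym2.mem_mk_left _ _), hℓ _ (h.2 ▸ Sym2.mem_mk_right _ _)⟩
      · have hne : a ≠ enum c Q i := fun h' => h.1 (h' ▸ ha)
        rw [Function.update_of_ne hne]
        exact hI a ha
    · rw [map_zero, map_zero, norm_zero]

end Bound

/-! ### Weighted cube integrals -/

section Weighted

variable {ι : Type*} [Fintype ι]

/-- **A weighted formal cube integral is bounded by the weight times the supremum**: for a real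
weight `w ≥ 0` on `[0,1]^ι` and `‖X(t)‖ ≤ C` there, `‖∫ w X‖ ≤ C ∫ w`. [folklore] -/
theorem norm_cubeIntegral_map_mul_le (w : MvPolynomial ι ℝ) (X : MvPolynomial ι 𝕜) {C : ℝ}
    (hw : ∀ t ∈ unitCube ι, 0 ≤ eval t w) (hX : ∀ t ∈ unitCube ι, ‖eval (fun i => (t i : 𝕜)) X‖ ≤ C) :
    ‖cubeIntegral ι 𝕜 (MvPolynomial.map (algebraMap ℝ 𝕜) w * X)‖ ≤ C * cubeIntegral ι ℝ w := by
  rw [cubeIntegral_eq_setIntegral, cubeIntegral_eq_setIntegral]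
  simp only [RCLike.ofReal_real_eq_id, id_eq]
  have hfun : ∀ t : ι → ℝ, eval (fun i => (t i : 𝕜)) (MvPolynomial.map (algebraMap ℝ 𝕜) w * X) =
      ((eval t w : ℝ) : 𝕜) * eval (fun i => (t i : 𝕜)) X := fun t => by
    rw [map_mul, eval_map_algebraMap]
  simp_rw [hfun]
  have hcube : MeasurableSet (unitCube ι) := MeasurableSet.univ_pi fun _ => measurableSet_Icc
  have hcontw : Continuous fun t : ι → ℝ => eval t w := MvPolynomial.continuous_eval w
  have hf : IntegrableOn (fun t : ι → ℝ => ‖((eval t w : ℝ) : 𝕜) * eval (fun i => (t i : 𝕜)) X‖) (unitCube ι) :=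
    (((RCLike.continuous_ofReal.comp hcontw).mul (continuous_eval_ofReal X)).norm).continuousOn.integrableOn_compact
      isCompact_unitCube
  have hg : IntegrableOn (fun t : ι → ℝ => eval t w * C) (unitCube ι) :=
    (hcontw.mul continuous_const).continuousOn.integrableOn_compact isCompact_unitCube
  calc ‖∫ t in unitCube ι, ((eval t w : ℝ) : 𝕜) * eval (fun i => (t i : 𝕜)) X‖
      ≤ ∫ t in unitCube ι, ‖((eval t w : ℝ) : 𝕜) * eval (fun i => (t i : 𝕜)) X‖ :=
        norm_integral_le_integral_norm _
    _ ≤ ∫ t in unitCube ι, eval t w * C := by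
        refine setIntegral_mono_on hf hg hcube fun t ht => ?_
        rw [norm_mul, RCLike.norm_ofReal, abs_of_nonneg (hw t ht)]
        exact mul_le_mul_of_nonneg_left (hX t ht) (hw t ht)
    _ = C * ∫ t in unitCube ι, eval t w := by
        rw [integral_mul_const, mul_comm]

end Weighted

/-! ### The bound on the truncated expectation -/

section Main

variable {ι : Type*} [Fintype ι] [DecidableEq ι] {F : Type*} [Fintype F] [LinearOrder F]
variable (c : F → ι) (A B : F → E)

/-- **The contribution of one script is bounded by the recursive Gram bound times its weight**:
`‖scriptTerm s‖ ≤ assignBound (lines s) · ∫ w_s`. [folklore] -/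
theorem norm_scriptTerm_le {v : ι} {k : ℕ} (s : Script v k) (hs : s.Valid) :
    ‖scriptTerm c (gramProp 𝕜 A B) v s‖ ≤
      assignBound 𝕜 c A B (enum c (univ.image s.y)) s.lines ∅ id * cubeIntegral ι ℝ (s.weight ℝ) := by
  rw [scriptTerm, weight_eq_map]
  refine norm_cubeIntegral_map_mul_le _ _ (fun t ht => eval_weight_nonneg s ht) fun t ht => ?_
  exact norm_eval_aeval_assignSum_le c A B s hs ht s.lines ∅ id fun a ha => absurd ha (notMem_empty a)

/-- **The `n!`-free bound on the truncated fermionic expectation** (Benfatto–Giuliani–Mastropietro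
2006, (2.66) with the Gram–Hadamard inequality; Mastropietro 2008, (2.118) and Lemma 2.2): for a
propagator in Gram form `G f f' = ⟪A f, B f'⟫`, the truncated expectation of the balanced monomials
of the clusters in `W` satisfies, for every root `v ∈ W`,
`‖𝓔ᵀ(W)‖ ≤ Σ_{valid scripts s rooted at v spanning W} assignBound (lines s) · ∫ w_s`, where
`assignBound` is the sum over the anchored field-line assignments along the lines of
`∏ ‖G_ℓ‖ ∏_{rows left} ‖A‖ ∏_{columns left} ‖B‖` and the weights `∫ w_s` of the scripts sharing an
anchored tree add up to one (`Script.sum_cubeIntegral_weight_eq_one`). [cite: BenfattoGiulianiMastropietro2006, (2.66)] -/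
theorem norm_ursellOf_moment_le (W : Finset ι) {v : ι} (hv : v ∈ W) :
    ‖ursellOf (moment c (gramProp 𝕜 A B)) W‖ ≤
      ∑ k ∈ range (Fintype.card ι), ∑ s : Script v k,
        if s.Valid ∧ univ.image s.y = W then
          assignBound 𝕜 c A B (enum c (univ.image s.y)) s.lines ∅ id * cubeIntegral ι ℝ (s.weight ℝ)
        else 0 := by
  rw [ursellOf_moment_eq_treeSum c _ W hv, treeSum]
  refine (norm_sum_le _ _).trans (sum_le_sum fun k _ => (norm_sum_le _ _).trans (sum_le_sum fun s _ => ?_))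
  split_ifs with h
  · exact norm_scriptTerm_le c A B s h.1
  · rw [norm_zero]

end Main

end FermionicTree

end Literature.MathematicalPhysics.QuantumLattice
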